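import Literature.Barriers.AnomalousDissipation.TwoDimensionalEnergyDissipationProofs
import Literature.Analysis.FluidPDE.DoeringFoiasPowerProofs
import Literature.Analysis.FluidPDE.LerayHopfRestartTorus
import Literature.Analysis.FluidPDE.LongTimeAverageShift
import HarnessLib

/-!
# Barrier (AnomalousDissipation): the Alexakis–Doering bound for all `L²` data, all smooth
  steady mean-zero forces, and `U ≥ 0`

Proof layer next to `TwoDimensionalEnergyDissipation(Proofs)`. The vendored barrier fact
`Literature.Barriers.AnomalousDissipation.AlexakisDoering2006_energyDissipationBound` (Alexakis–
Doering, Phys. Lett. A 359 (2006), §2) is rendered for forces `F Φ(n • x)`, SMOOTH data and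
`U > 0`; its audit (module docstring of `TwoDimensionalEnergyDissipation`) records that these
restrictions are inessential: "any `L²` datum gives a smooth slice at positive time and the
`limsup` means are shift invariant", and `U = 0` forces `ε = 0`. This file proves the
unrestricted two-dimensional statement in the form actually used downstream:

* `meanDissipation_sq_le_of_enstrophyIneq_of_isBoundedUnder` — "(trickI)" `ε² ≤ ν U² χ` under
  the enstrophy inequality with BOUNDED running means of the energy in place of `U > 0` (any
  dimension; `Literature.Analysis.FluidPDE.meanDissipation_sq_le_of_regular`);
* `meanDissipation_sq_le_of_H1` — on `𝕋²`, `ν > 0`, `g` smooth steady with `∫g = 0`,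
  `‖Δg‖_∞ ≤ K`, datum `u₀ ∈ L² ∩ H¹` weakly divergence free: EVERY global Leray–Hopf solution
  has `ε² ≤ ν K U³` (`U ≥ 0` allowed): `ε² ≤ ν U² χ` and, for `U > 0`, `χ ≤ K U`
  (`meanEnstrophyDissipation_le_of_enstrophyIneq`), the enstrophy inequality and the
  `L²(0,T;H²)` regularity of every Leray–Hopf solution being supplied by 2-D uniqueness
  (`lions_prodi_uniqueness_torus2_holds.enstrophyIneq`, `memL2Sobolev_two_of_lionsProdi`) and
  the bounded running means of the energy by the Doering–Foias a-priori estimate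
  (`Torus.IsGlobalLerayHopf.timeMean_norm_sq_le`, which uses `∫g = 0`);
* `meanDissipation_sq_le_of_L2` — the same for an ARBITRARY datum (the Leray–Hopf predicate
  only sees `u₀` through `L²` quantities): restart `u` at a time `s > 0` with `u(s) ∈ H¹` from
  which the energy inequality holds (`Torus.IsGlobalLerayHopf.exists_isGlobalLerayHopf_translate`,
  `LerayHopfRestartTorus`), apply the `H¹` statement to `u(· + s)`, and transfer back by the
  translation invariance of `ε` and `U` (`LongTimeAverageShift`);
* `tendsto_meanDissipation_zero_of_L2` — **no two-dimensional energy-dissipation anomaly**: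
  for every smooth steady mean-zero `g` on `𝕋²` (including `g = 0`), `ν_j > 0`, `ν_j → 0`, and
  global Leray–Hopf solutions `u_j` (any `L²` data) with `sup_j ⟨‖u_j‖₂²⟩ ≤ E`:
  `⟨ν_j‖∇u_j‖₂²⟩ → 0`, at rate `ε_j ≤ (ν_j K E^{3/2})^{1/2}` (Alexakis–Doering 2006, §1–2 and §5:
  "there is no residual dissipation in the vanishing viscosity limit").

## References

* A. Alexakis, C. R. Doering, *Energy and enstrophy dissipation in steady state 2d
  turbulence*, Phys. Lett. A 359 (2006), §2, arXiv v1 eqs. (16), (21), and §5.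
  [AlexakisDoering2006PLA]
* C. Foias, O. Manley, R. Rosa, R. Temam, *Navier–Stokes Equations and Turbulence*, CUP 2001,
  Ch. II Thm. 7.3–7.4, (7.16)–(7.17). [FoiasManleyRosaTemam2001]
-/

open MeasureTheory Set Filter Topology
open scoped ENNReal NNReal RealInnerProductSpace

noncomputable section

namespace Literature.Barriers.AnomalousDissipation

open Literature.Analysis.FluidPDE Literature.Analysis.FunctionSpaces

/-! ### "(trickI)" with bounded energy means in place of `U > 0` -/

section TrickI

variable {d : Type*} [Fintype d] [DecidableEq d] {ν : ℝ}
  {f : UnitAddTorus d → EuclideanSpace ℝ d} {u : ℝ → UnitAddTorus d → EuclideanSpace ℝ d}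
  {u₀ : UnitAddTorus d → EuclideanSpace ℝ d}

/-- **`ε² ≤ ν U² χ` under `L²_t H²_x` regularity, the enstrophy inequality and bounded running
means of the energy** (Alexakis–Doering 2006, §2, arXiv v1 eq. (21)), on `T^d` for any `d`:
the variant of `Literature.Analysis.FluidPDE.meanDissipation_sq_le_of_enstrophyIneq` in which
the hypothesis `0 < U` (used there only to make the running means of the energy bounded) is
replaced by that boundedness itself, so that `U = 0` is allowed. [cite: AlexakisDoering2006PLA, §2 eq. (21)] -/
theorem meanDissipation_sq_le_of_enstrophyIneq_of_isBoundedUnder (hν : 0 < ν)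
    (hf : Torus.IsSmooth f) (hu : Torus.IsGlobalLerayHopf ν (fun _ => f) u₀ u)
    (hreg : ∀ T, 0 < T → Torus.MemL2Sobolev 0 T 2 (fun t => EuclideanSpace.complexify ∘ u t))
    (hineq : ∀ t, 0 < t → ν * ∫ s in Ioc 0 t, (eLaplacianNormSq (u s)).toReal ≤
      2⁻¹ * (Torus.eGradNormSq u₀).toReal - ∫ s in Ioc 0 t, ∫ x, ⟪Torus.laplacian f x, u s x⟫)
    (hEb : IsBoundedUnder (· ≤ ·) atTop (timeMean fun t => ∫ x, ‖u t x‖ ^ 2)) :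
    meanDissipation ν u ^ 2 ≤
      ν * rmsVelocity longTimeAvgSup u ^ 2 * meanEnstrophyDissipation ν u := by
  refine meanDissipation_sq_le_of_regular hν.le ?_ (hu.ae_eLaplacianNormSq_ne_top hreg)
    hu.aestronglyMeasurable_toReal_eGradNormSq (fun T hT => hu.integrableOn_integral_norm_sq hT)
    (fun T hT => (hu T hT).integrableOn_toReal_eLaplacianNormSq (hreg T hT)) hEb
    (isBoundedUnder_timeMean_eLaplacianNormSq_of_enstrophyIneq hν hf hu hineq hEb)
  filter_upwards [ae_restrict_mem measurableSet_Ioi] with t ht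
  exact hu.memLp_two (le_of_lt ht)

end TrickI

/-! ### The planar bound `ε² ≤ ν ‖Δg‖_∞ U³` -/

section Planar

/-- The flat two-torus `T²` (local notation). -/
local notation "𝕋²" => UnitAddTorus (Fin 2)
/-- Velocity values on `T²` (local notation). -/
local notation "E²" => EuclideanSpace ℝ (Fin 2)

variable {ν : ℝ} {g : 𝕋² → E²} {u₀ : 𝕋² → E²} {u : ℝ → 𝕋² → E²}

/-- **Alexakis–Doering for `H¹` data and `U ≥ 0`** (Alexakis–Doering 2006, §2, eqs. (16) and
(21): `χ ≤ ‖Δg‖_∞ U`, `ε² ≤ ν U² χ`). On `𝕋²`, for `ν > 0`, a smooth steady force `g` with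
`∫ g = 0` and `‖Δg‖ ≤ K`, a datum `u₀ ∈ L²` with `‖∇u₀‖₂ < ∞`, weakly divergence free, and EVERY
global Leray–Hopf solution `u`: `ε² ≤ ν K U³` (`ε = meanDissipation ν u`, `U = ⟨‖u‖₂²⟩^{1/2}`,
`limsup` averages). The enstrophy inequality and `L²(0,T;H²)` regularity of `u` come from 2-D
uniqueness (`lions_prodi_uniqueness_torus2_holds`); the running means of the energy are
bounded by the Doering–Foias a-priori estimate (this is where `∫g = 0` enters), which makes
"(trickI)" honest also when `U = 0`. [cite: AlexakisDoering2006PLA, §2 eqs. (16), (21)] -/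
theorem meanDissipation_sq_le_of_H1 (hν : 0 < ν) (hg : Torus.IsSmooth g)
    (hg0 : Torus.HasZeroMean g) {K : ℝ} (hK : 0 ≤ K) (hgK : ∀ x, ‖Torus.laplacian g x‖ ≤ K)
    (hu₀ : MemLp u₀ 2 volume) (hG : Torus.eGradNormSq u₀ ≠ ⊤) (hdiv : Torus.IsWeaklyDivFree u₀)
    (hu : Torus.IsGlobalLerayHopf ν (fun _ => g) u₀ u) :
    meanDissipation ν u ^ 2 ≤ ν * K * rmsVelocity longTimeAvgSup u ^ 3 := by
  have hUq := lions_prodi_uniqueness_torus2_holds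
  have hreg : ∀ T, 0 < T → Torus.MemL2Sobolev 0 T 2 (fun t => EuclideanSpace.complexify ∘ u t) :=
    fun T hT => memL2Sobolev_two_of_lionsProdi hUq hν hg hu₀ hG hdiv hu hT
  have hineq : ∀ t, 0 < t → ν * ∫ s in Ioc 0 t, (eLaplacianNormSq (u s)).toReal ≤
      2⁻¹ * (Torus.eGradNormSq u₀).toReal - ∫ s in Ioc 0 t, ∫ x, ⟪Torus.laplacian g x, u s x⟫ :=
    fun t ht => (hUq.enstrophyIneq hν hg hu₀ hG hdiv hu ht).2
  -- bounded running means of the energy (Doering–Foias a-priori estimate)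
  have hEb : IsBoundedUnder (· ≤ ·) atTop (timeMean fun t => ∫ x, ‖u t x‖ ^ 2) :=
    isBoundedUnder_of_eventually_le (eventually_atTop.2 ⟨1, fun T hT =>
      Torus.IsGlobalLerayHopf.timeMean_norm_sq_le hν hg hg0 hu hT⟩)
  have h1 := meanDissipation_sq_le_of_enstrophyIneq_of_isBoundedUnder hν hg hu hreg hineq hEb
  set U := rmsVelocity longTimeAvgSup u with hUdef
  have hU0 : 0 ≤ U := Real.sqrt_nonneg _
  rcases hU0.eq_or_lt with hU | hU
  · -- `U = 0`: `ε² ≤ ν · 0 · χ = 0`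
    rw [← hU] at h1 ⊢
    simpa using h1
  · have h2 : meanEnstrophyDissipation ν u ≤ K * U :=
      meanEnstrophyDissipation_le_of_enstrophyIneq hν hu hK hgK hineq hU
    calc meanDissipation ν u ^ 2 ≤ ν * U ^ 2 * meanEnstrophyDissipation ν u := h1
      _ ≤ ν * U ^ 2 * (K * U) :=
          mul_le_mul_of_nonneg_left h2 (mul_nonneg hν.le (sq_nonneg U))
      _ = ν * K * U ^ 3 := by ring

/-- **Alexakis–Doering for ALL data and `U ≥ 0`** (Alexakis–Doering 2006, §2 with the restart
at positive time, cf. Foias–Manley–Rosa–Temam 2001, Ch. II (7.16)–(7.17)). On `𝕋²`, for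
`ν > 0`, a smooth steady force `g` with `∫ g = 0` and `‖Δg‖ ≤ K`, and EVERY global Leray–Hopf
solution `u` from an arbitrary datum: `ε² ≤ ν K U³`. Proof: restart `u` at a time `s > 0` with
`‖∇u(s)‖₂ < ∞` from which the energy inequality holds — the translate `u(· + s)` is a global
Leray–Hopf solution from `u(s) ∈ L² ∩ H¹`, weakly divergence free
(`Torus.IsGlobalLerayHopf.exists_isGlobalLerayHopf_translate`) — apply
`meanDissipation_sq_le_of_H1` to it, and use that `ε` and `U` do not see the translation
(`Torus.IsGlobalLerayHopf.meanDissipation_translate`, `…meanEnergy_translate`). [cite: AlexakisDoering2006PLA, §2 eqs. (16), (21)] -/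
theorem meanDissipation_sq_le_of_L2 (hν : 0 < ν) (hg : Torus.IsSmooth g)
    (hg0 : Torus.HasZeroMean g) {K : ℝ} (hK : 0 ≤ K) (hgK : ∀ x, ‖Torus.laplacian g x‖ ≤ K)
    (hu : Torus.IsGlobalLerayHopf ν (fun _ => g) u₀ u) :
    meanDissipation ν u ^ 2 ≤ ν * K * rmsVelocity longTimeAvgSup u ^ 3 := by
  obtain ⟨s, hs, hGs, hw⟩ := hu.exists_isGlobalLerayHopf_translate hg hν.le
  have h := meanDissipation_sq_le_of_H1 hν hg hg0 hK hgK (hu.memLp_two hs.le) hGs.ne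
    hw.isWeaklyDivFree_datum hw
  have hε : meanDissipation ν (fun t => u (t + s)) = meanDissipation ν u :=
    hu.meanDissipation_translate hν.le hs.le
  have hU : rmsVelocity longTimeAvgSup (fun t => u (t + s)) = rmsVelocity longTimeAvgSup u := by
    rw [rmsVelocity_eq_sqrt_meanEnergy, rmsVelocity_eq_sqrt_meanEnergy, hu.meanEnergy_translate hs.le]
  rwa [hε, hU] at h

/-- The bound in terms of the mean energy: `ε ≤ (ν K E^{3/2})^{1/2}` whenever
`⟨‖u‖₂²⟩ ≤ E` (`U = ⟨‖u‖₂²⟩^{1/2} ≤ E^{1/2}`, `U³ ≤ E^{1/2} · E`). [cite: AlexakisDoering2006PLA, §2 eqs. (16), (21)] -/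
theorem meanDissipation_le_sqrt_of_L2 (hν : 0 < ν) (hg : Torus.IsSmooth g)
    (hg0 : Torus.HasZeroMean g) {K : ℝ} (hK : 0 ≤ K) (hgK : ∀ x, ‖Torus.laplacian g x‖ ≤ K)
    (hu : Torus.IsGlobalLerayHopf ν (fun _ => g) u₀ u) {E : ℝ} (hE : meanEnergy u ≤ E) :
    meanDissipation ν u ≤ Real.sqrt (ν * K * (Real.sqrt E * E)) := by
  have h := meanDissipation_sq_le_of_L2 hν hg hg0 hK hgK hu
  have hE0 : 0 ≤ E := (meanEnergy_nonneg u).trans hE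
  have hU : rmsVelocity longTimeAvgSup u ≤ Real.sqrt E := by
    rw [rmsVelocity_eq_sqrt_meanEnergy]
    exact Real.sqrt_le_sqrt hE
  have hU0 : 0 ≤ rmsVelocity longTimeAvgSup u := Real.sqrt_nonneg _
  have hU3 : rmsVelocity longTimeAvgSup u ^ 3 ≤ Real.sqrt E * E := by
    calc rmsVelocity longTimeAvgSup u ^ 3 ≤ Real.sqrt E ^ 3 := by gcongr
      _ = Real.sqrt E * E := by
          rw [pow_succ, pow_two, Real.mul_self_sqrt hE0, mul_comm]
  have h2 : meanDissipation ν u ^ 2 ≤ ν * K * (Real.sqrt E * E) :=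
    h.trans (mul_le_mul_of_nonneg_left hU3 (mul_nonneg hν.le hK))
  have h3 := Real.sqrt_le_sqrt h2
  rwa [Real.sqrt_sq (meanDissipation_nonneg hν.le u)] at h3

/-- **No two-dimensional energy-dissipation anomaly, for all `L²` data** (Alexakis–Doering
2006, §1–2 and §5: `β ≲ Re^{-1/2}`, "there is no residual dissipation in the vanishing
viscosity limit"; here without the restrictions of the vendored corollary
`AlexakisDoering2006_energyDissipationBound.no_twoDimensional_zerothLaw` to forces
`F Φ(n • x)`, smooth data and `U_j > 0`). For every smooth steady mean-zero force `g` on `𝕋²`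
(including `g = 0`), viscosities `ν_j > 0` with `ν_j → 0`, and global Leray–Hopf solutions
`u_j` of the 2-D Navier–Stokes equations forced by `g` from arbitrary data, with uniformly
bounded mean energy `⟨‖u_j‖₂²⟩ ≤ E`: the mean energy dissipation rates tend to zero,
`⟨ν_j‖∇u_j‖₂²⟩ → 0` — squeezed between `0` and `(ν_j ‖Δg‖_∞ E^{3/2})^{1/2} → 0`
(`meanDissipation_le_sqrt_of_L2`). [cite: AlexakisDoering2006PLA, §2 and §5] -/
theorem tendsto_meanDissipation_zero_of_L2 (g : 𝕋² → E²) (hg : Torus.IsSmooth g)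
    (hg0 : Torus.HasZeroMean g) (ν : ℕ → ℝ) (u₀ : ℕ → 𝕋² → E²) (u : ℕ → ℝ → 𝕋² → E²)
    (hν : ∀ j, 0 < ν j) (hν0 : Tendsto ν atTop (𝓝 0))
    (hu : ∀ j, Torus.IsGlobalLerayHopf (ν j) (fun _ => g) (u₀ j) (u j))
    (hE : ∃ E : ℝ, ∀ j, meanEnergy (u j) ≤ E) :
    Tendsto (fun j => meanDissipation (ν j) (u j)) atTop (𝓝 0) := by
  obtain ⟨E, hE⟩ := hE
  obtain ⟨K, hK, hgK⟩ := Torus.exists_nonneg_forall_norm_le_of_continuous hg.laplacian.continuous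
  -- the dominating sequence `B j = (ν_j K E^{3/2})^{1/2}`
  let B : ℕ → ℝ := fun j => Real.sqrt (ν j * K * (Real.sqrt E * E))
  have hB : Tendsto B atTop (𝓝 0) := by
    have h1 : Tendsto (fun j => ν j * K * (Real.sqrt E * E)) atTop (𝓝 (0 * K * (Real.sqrt E * E))) :=
      (hν0.mul_const K).mul_const _
    rw [zero_mul, zero_mul] at h1
    have h2 := (Real.continuous_sqrt.tendsto 0).comp h1
    rwa [Real.sqrt_zero] at h2
  refine squeeze_zero (fun j => meanDissipation_nonneg (hν j).le (u j)) (fun j => ?_) hB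
  exact meanDissipation_le_sqrt_of_L2 (hν j) hg hg0 hK hgK (hu j) (hE j)

end Planar

end Literature.Barriers.AnomalousDissipation

end
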